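import Literature.NumberTheory.Sieve.LargestPrimeFactorCubicS0Swap
import Literature.NumberTheory.Sieve.LargestPrimeFactorCubicRegionBridge
import Literature.NumberTheory.Sieve.LargestPrimeFactorCubicABCount
import Literature.NumberTheory.Sieve.LargestPrimeFactorCubicSigmaFactor
import HarnessLib

/-!
# Heath-Brown 2001 (PLMS), §§4, 6, 8: the weight of one cube, `W_𝓑 = ∑_{(a,b)} W(a,b) ≥
# m f(q)σ₁(q)σ₂(q) − (error)` summed over the base pairs of the cube face

Topic `Literature/NumberTheory/Sieve`; a PROVED structural layer (no definitions, no named facts) under the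
named fact `Irving2015_largestPrimeFactor_cubic` (`LargestPrimeFactorCubic.lean`), joining `…S0Swap` (the
signed generator weight `wgen`), `…RegionBridge` (cube/face/edge decomposition of `regionGens`), `…ABCount`
(`Wab`, the sieve-weighted `c`-count) and `…SigmaFactor` (`σ₁σ₂`).  Source: D. R. Heath-Brown, *The largest
prime factor of `X³ + 2`*, Proc. London Math. Soc. (3) 82 (2001) 554–596, §4 p. 16 ("we now see that
`#{α ∈ 𝓑 : d ∣ N(J)} = ∑_{a,b} #{t : …}`"), §6 pp. 21–22 (`ρ(K,d)M/(N(K)d)` main term, `f(q)σ₁(q)σ₂(q)`),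
§8 p. 30 ((8.1): `S₀ = ∑_𝓑 ∑_{α∈𝓑} N(α)⁻¹ ∑ ∑ λ_d`).  PROVED:

* `sum_edge_wgen_eq` — `∑_{c ∈ edge, CCond} wgen(a,b,c) = W(a,b)` (`…ABCount.Wab` with `q = |a³ − 2b³|`);
* `cube_weight_eq` — `∑_{v ∈ cube, base ∧ CCond} wgen(v) = ∑_{(a,b) ∈ face, base} W(a,b)`;
* **`Wab_ge`** — `W(a,b) ≥ m f(q) σ₁(q)σ₂(q) − 3^{ω(q)} · 3#𝒦 · ∑_{d < X^{3δ}} ρ(d)` (`X ≥ 2`, all `p ∈ 𝒦` odd).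

## References

* D. R. Heath-Brown, *The largest prime factor of `X³ + 2`*, Proc. London Math. Soc. (3) 82 (2001)
  554–596, §4 p. 16, §6 pp. 21–22, §8 p. 30. [`HeathBrown2001LargestPrimeFactorCubic`]

## Mathlib / tree search

Tree: `wgen` (`…S0Swap`), `sum_cubePoints_filter_eq`, `ccond_iff`, `qf_pos_of_good`, `hbPair_of_good`
(`…RegionBridge`), `Wab`, `cCount`, `absNorm_span_coordElt_eq`, `abs_Wab_sub_le` (`…ABCount`),
`sum_lam_Aind_rho_eq`, `sum_abs_lam_Aind_rho_le`, `sum_abs_lam_rho_le`, `sigma1`, `sigma2` (`…SigmaFactor`),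
`qf`, `CCond`, `cubePoints`, `IsBasePair`, `kPrimes`, `sievePrimes`, `lam`, `normNat` (`…Setup`/`…Region`).
-/

noncomputable section

open Finset Real

namespace Literature.NumberTheory.Sieve.HeathBrown2001

open LargestPrimeFactorCubic
open scoped Classical

/-- **`∑_{c ∈ (C, C+m], CCond(a,b,c)} wgen(a,b,c) = W(a,b)`** with `q = |a³ − 2b³| > 0`.
[cite: HeathBrown2001LargestPrimeFactorCubic, §4 p. 16] -/
theorem sum_edge_wgen_eq (X a b C m : ℕ) (hq : 0 < qf a b) :
    ∑ c ∈ (Ioc C (C + m)).filter (fun c => CCond (a, b, c)), wgen X (a, b, c) =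
      Wab X a b (qf a b).natAbs C m := by
  set E := (Ioc C (C + m)).filter (fun c => CCond (a, b, c)) with hE
  -- expand both sides into indicator sums
  have hw : ∀ c : ℕ, wgen X (a, b, c) = ∑ d ∈ (sievePrimes X).divisors, ∑ p ∈ kPrimes X,
      lam X d * (if p * d ∣ normNat (a, b, c) then (1 : ℝ) else 0) := by
    intro c
    rw [wgen]
    refine sum_congr rfl fun d _ => ?_
    rw [card_filter, Nat.cast_sum, mul_sum]
    refine sum_congr rfl fun p _ => ?_
    split_ifs <;> simp
  have hc : ∀ e : ℕ, (cCount a b (qf a b).natAbs C m e : ℝ) =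
      ∑ c ∈ E, if e ∣ normNat (a, b, c) then (1 : ℝ) else 0 := by
    intro e
    rw [cCount, card_filter, Nat.cast_sum, hE, sum_filter]
    refine sum_congr rfl fun c _ => ?_
    simp only [absNorm_span_coordElt_eq]
    have hiff := ccond_iff (c := c) hq
    by_cases h1 : CCond (a, b, c)
    · have h1' := hiff.mp h1
      by_cases h2 : e ∣ normNat (a, b, c)
      · rw [if_pos ⟨h1', h2⟩, if_pos h1, if_pos h2]; simp
      · rw [if_neg (fun h => h2 h.2), if_pos h1, if_neg h2]; simp
    · have h1' : ¬ (Int.gcd ((b : ℤ) ^ 2 - a * c) ((qf a b).natAbs : ℕ) = 1 ∧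
          Int.gcd ((a : ℤ) ^ 2 + b * c) ((qf a b).natAbs : ℕ) = 1) := fun h => h1 (hiff.mpr h)
      rw [if_neg (fun h => h1' h.1), if_neg h1]; simp
  rw [sum_congr rfl fun c _ => hw c, Wab, sum_comm]
  refine sum_congr rfl fun d _ => ?_
  rw [sum_comm, mul_sum]
  refine sum_congr rfl fun p _ => ?_
  rw [hc, mul_sum]

/-- **The weight of one good cube**: `∑_{v ∈ cube, base ∧ CCond} wgen(v) = ∑_{(a,b) ∈ face, base} W(a,b)`.
[cite: HeathBrown2001LargestPrimeFactorCubic, §4 p. 16, §8 (8.1)] -/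
theorem cube_weight_eq {X m : ℕ} {ABC : ℕ × ℕ × ℕ} (hgood : IsGoodCube X m ABC) :
    ∑ v ∈ (cubePoints ABC m).filter (fun v => IsBasePair X (v.1, v.2.1) ∧ CCond v), wgen X v =
      ∑ ab ∈ (Ioc ABC.1 (ABC.1 + m) ×ˢ Ioc ABC.2.1 (ABC.2.1 + m)).filter (IsBasePair X),
        Wab X ab.1 ab.2 (qf ab.1 ab.2).natAbs ABC.2.2 m := by
  rw [sum_cubePoints_filter_eq]
  refine sum_congr rfl fun ab hab => ?_
  rw [mem_filter, mem_product] at hab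
  -- `q > 0` via a point of the cube above `(a, b)` (the edge is nonempty as the face is)
  have hm : 0 < m := by
    have := hab.1.1; rw [mem_Ioc] at this; omega
  have hv : (ab.1, ab.2, ABC.2.2 + 1) ∈ cubePoints ABC m := by
    rw [cubePoints, mem_product, mem_product]
    refine ⟨hab.1.1, hab.1.2, mem_Ioc.mpr ⟨?_, ?_⟩⟩
    · show ABC.2.2 < ABC.2.2 + 1; omega
    · show ABC.2.2 + 1 ≤ ABC.2.2 + m; omega
  have hq : 0 < qf ab.1 ab.2 := qf_pos_of_good hgood hv
  exact sum_edge_wgen_eq X ab.1 ab.2 ABC.2.2 m hq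

/-- **`W(a,b) ≥ m f(q) σ₁(q)σ₂(q) − 3^{ω(q)} · 3#𝒦 · ∑_{d<X^{3δ}} ρ(d)`** for an `HBPair a b q`, `X ≥ 2`, all
`p ∈ 𝒦` odd. [cite: HeathBrown2001LargestPrimeFactorCubic, §6 pp. 21–22] -/
theorem Wab_ge {X a b q : ℕ} (h : HBPair a b q) (hk : ∀ p ∈ kPrimes X, Odd p) (hX : 2 ≤ X) (C m : ℕ) :
    (m : ℝ) * fq q * (sigma1 X q * sigma2 X q) -
        (3 : ℝ) ^ q.primeFactors.card * (3 * #(kPrimes X) * ∑ d ∈ Finset.range ⌈(X : ℝ) ^ (3 * hbδ)⌉₊, (#(rootsCube d) : ℝ)) ≤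
      Wab X a b q C m := by
  have h1 := abs_Wab_sub_le (X := X) h hk C m
  rw [sum_lam_Aind_rho_eq] at h1
  have h2 := sum_abs_lam_Aind_rho_le X q
  have h3 := sum_abs_lam_rho_le hX
  have h4 : (3 : ℝ) ^ q.primeFactors.card * ∑ d ∈ (sievePrimes X).divisors, |lam X d| *
      ∑ p ∈ kPrimes X, Aind q d p * rho3 (p * d) ≤
      (3 : ℝ) ^ q.primeFactors.card * (3 * #(kPrimes X) * ∑ d ∈ Finset.range ⌈(X : ℝ) ^ (3 * hbδ)⌉₊, (#(rootsCube d) : ℝ)) := by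
    refine mul_le_mul_of_nonneg_left (h2.trans ?_) (by positivity)
    exact mul_le_mul_of_nonneg_left h3 (by positivity)
  have := (abs_le.mp h1).1
  linarith [mul_assoc (m : ℝ) (fq q) (sigma1 X q * sigma2 X q)]

end Literature.NumberTheory.Sieve.HeathBrown2001
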